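import Summits.QuantumFields.YangMills.Theorems.BalabanUVNodesN15SmallFieldSiteLayerAnyPropagator
import Summits.QuantumFields.YangMills.Theorems.BalabanUVNodesN15SmallFieldUnitLayerAnyPropagator
import HarnessLib

/-!
# N15 = NE2 — PROGRAMME 𝟙P «ONE PROPAGATOR», part (𝟙P-e′): dag-n15-c's FILE 133 PROPAGATOR FAMILY (covariant averaging summand FLAT inside) MEETS THE THREE DISPLAYED ROWS — non-vacuity and
# consistency of the generic socket: (Q-3)'s site layer and (Q-4)'s unit layer recovered through (𝟙P-c) ∕ (𝟙P-d)
# (dag-n15-a g32, FILE (𝟙P-e′); node N15 = NE2; `--kind proof --supports stmt-QuantumFields-27366 --as helper`, count-neutral; theorems only, 0 def; imports (𝟙P-c), (𝟙P-d))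

WHY.  (𝟙P-c) `ne2PlusSite_foSiteAny` and (𝟙P-d) `ne2PlusUnit_foCovAnyLam` display the inner propagator family by THREE rows on its increment over the flat zero-field pair (size
`K_X·(c₃₅L^mα₀)` at both spacings, two-grid defect `K_X·(L^k)^{−1∕16}`, under `Reg335` in a window on large cubes).  This file proves that the propagator (Q-2a)∕(Q-3)∕(Q-4) HARD-WIRE —
dag-n15-c's FILE 133 `cvGlued … (cvNL) 0` ∕ FILE 128 `cvGlued′ … (cvNL′) 0` — meets them: (I-b) `exists_hasMaj_cvGlued_sub_tensorId_gOp` (size `K_b κ_e r_A`) and (I-c)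
`exists_hasMaj_idef_cvGlued_sub_tensorId_gOp` (defect `K_c((L^k)^{−1∕16} + κ_e r_A (L^k)⁻¹)`) in FILE 133's regime, which `sfInstance_reg335_iff` + a window `s_X` on `r_A = c₃₅L^mα₀` supply
(`W r_A ≤ 1`, `σ κ_e JJ r_A ≤ min(R_b, R_c)`); `K_X = max(K_b κ_e, K_c(1 + κ_e))`, rate `min(δ_b, δ_c)`, cube floor `max(w_b, w_c)`.  Hence the generic layers at this family — whose kernels ARE
(Q-3)'s ∕ (Q-4)'s pointwise ((𝟙P-c) `foSiteAny_cvGlued`, (𝟙P-d) `foCovAnyLam_cvGlued`) — hold: the socket is inhabited by the lane's previous object, nothing in (𝟙P-c)∕(𝟙P-d) is void.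

WHAT.  ★ `rows_cvGlued` (the three rows, `hX`'s shape verbatim), ★ `ne2PlusSite_foSiteAny_cvGlued`, ★ `ne2PlusUnit_foCovAnyLam_cvGlued` (one `exact` each into (𝟙P-c)∕(𝟙P-d)).

HONEST FRAMING ∕ LIMITS.  Bookkeeping over (I-b)∕(I-c); MODEL carriers of dag-n15-c FILE 130∕133 (two-spacing glued doubled torus, global small-field gauge `u ≡ 1`, covariant averaging summand
FLAT in this propagator, Landau summand flat, `Reg336` idle, `L ≥ 7`); NOT [B9] Thms 3.1∕3.2∕3.15 AS PRINTED; N15 stays DISCHARGED OF RECORD 8∕28 AS CONSUMED (U-blind v7 pin, p687738) — nothing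
re-claimed, no count moved; K3⁸ OPEN; finite 𝕋⁴ per index — NOT ℝ⁴ ∕ OS ∕ mass gap ∕ Clay.  `set_option maxHeartbeats 400000 in` ×1.  No `sorry`, `def`, `instance`, `notation`; standard axioms.
[cite: Balaban1985BackgroundPropagators, (3.62)–(3.65) pp.402–403, Thm 3.1 (3.42) p.397, Thm 3.2 (3.48) p.398, Thm 3.15 (3.187) p.432 (shapes), (3.35) p.396; Balaban1984PropagatorsI, Prop. 1.2 (1.110)–(1.111) p.35; King1986, p.664 (pairing)]
-/

noncomputable section

open scoped BigOperators Matrix Matrix.Norms.Frobenius Kronecker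

namespace Summit.QuantumFields.YangMills.BalabanUVNodes.N15.SiteLayerSf

open Literature.MathematicalPhysics.QuantumFieldTheory.Balaban1983to89
open Literature.MathematicalPhysics.QuantumFieldTheory.Balaban1983to89.T4EtaRate (PairedInstance NE2PlusSite NE2PlusUnit)
open Literature.MathematicalPhysics.QuantumFieldTheory.Balaban1983to89.T4EtaRateDefect (idef)
open Literature.MathematicalPhysics.QuantumFieldTheory.Balaban1983to89.T4EtaRateCoeffDefect (pull)
open Literature.MathematicalPhysics.QuantumFieldTheory.Balaban1983to89.B11SectG (BlockNorm HasMaj)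
open Literature.MathematicalPhysics.QuantumFieldTheory.Balaban1983to89.B5Prop11Plancherel (Tor fine)
open Literature.MathematicalPhysics.QuantumFieldTheory.Balaban1983to89.B6UnitTorusCarrier (unitTorusGeo unitTorusGeo_dist_nonneg)
open Literature.MathematicalPhysics.QuantumFieldTheory.King1986.Torus (blockOf tdistT)
open Literature.Barriers.QuantumFields (traceForm)
open Summit.QuantumFields.YangMills.BalabanUVNodes.N15.SiteLayer (hasMaj_exp_mono)
open Summit.QuantumFields.YangMills.BalabanUVNodes.N15.VectorPiece (bshiftEquiv kingPrV tensorId blkFine_comp_kingPrV)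
open Summit.QuantumFields.YangMills.BalabanUVNodes.N15.MatrixSpecies (basisConst basisConst_nonneg liftBlk liftMap)
open Summit.QuantumFields.YangMills.BalabanUVNodes.N15.BackgroundLayer (gavgM)
open Summit.QuantumFields.YangMills.BalabanUVNodes.N15.TwoGrid (gOp)
open Summit.QuantumFields.YangMills.BalabanUVNodes.N15.Gluing (SfIdx sfGeo sfInstance sfInstance_reg335_iff sfInstance_gf_M CvX CvX' cvM cvBlk CvNorm cvNL cvNL' cvGlued cvGlued')
open Summit.QuantumFields.YangMills.BalabanUVNodes.N15.GluedZeroField (exists_hasMaj_cvGlued_sub_tensorId_gOp exists_hasMaj_idef_cvGlued_sub_tensorId_gOp)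

variable {d : ℕ} {L : ℕ} [NeZero L] {mm ι : Type} [Fintype mm] [DecidableEq mm] [Fintype ι] [DecidableEq ι] {a : ℝ} {e : Matrix mm mm ℂ ≃L[ℝ] (ι → ℝ)}

/-! ## §1 The three rows at dag-n15-c's FILE 133 propagator family -/

set_option maxHeartbeats 400000 in
/-- ★ **dag-n15-c's FILE 133 PROPAGATOR FAMILY MEETS THE THREE DISPLAYED ROWS** (`L ≥ 7` odd, `a > 0`, trace-form-orthonormal `e`, `ι` nonempty): under `Reg335 c₃₅ α₀ A′` in the window
`c₃₅L^mα₀ ≤ s_X` on cubes `L^m ≥ w_X`, the increments of `(X′(e^{η′A′}), X(e^{ηĀ′}))` over the flat pair carry (I-b)'s size `K_X·(c₃₅L^mα₀)` at both spacings and (I-c)'s two-grid defect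
`K_X·(L^k)^{−1∕16}` at the common rate `min(δ_b, δ_c)` — the hypothesis `hX` of `ne2PlusSite_foSiteAny` is inhabited by the propagator (Q-3) hard-wires. [cite: Balaban1985BackgroundPropagators, (3.62)–(3.65) pp.402–403, Thm 3.1 (3.42) p.397 (shapes); Balaban1984PropagatorsI, Prop. 1.2 (1.110)–(1.111) p.35] -/
theorem rows_cvGlued [Nonempty ι] (hL : Odd L ∧ 1 < L) (hL7 : 7 ≤ L) (ha : 0 < a) {c35 : ℝ} (hc35 : 0 < c35) (he : ∀ A B : Matrix mm mm ℂ, traceForm A B = e A ⬝ᵥ e B) :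
    ∃ ρX KX wX sX : ℝ, 0 < ρX ∧ 0 ≤ KX ∧ 0 < sX ∧
      ∀ (i : SfIdx d L) (α₀ : ℝ) (A' : Fin (d + 1) → CvX' d L i.m i.kk i.r hL → Matrix mm mm ℂ), 0 < α₀ → wX ≤ ((L ^ i.m : ℕ) : ℝ) → c35 * (L : ℝ) ^ i.m * α₀ ≤ sX →
        (sfInstance d mm ι hL i).Bf.Reg335 c35 α₀ A' →
        HasMaj (CvNorm d L i.m i.kk hL ι) (CvNorm d L i.m i.kk hL ι)
          (cvGlued d L i.m i.kk hL a ((((L ^ i.kk : ℕ) : ℝ))⁻¹) ι e (fun _ _ => (1 : Matrix mm mm ℂ))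
              (fun μ x => NormedSpace.exp (((((L ^ i.kk : ℕ) : ℝ))⁻¹) • gavgM (Matrix mm mm ℂ) (Fin (d + 1)) (kingPrV L i.kk i.r (cvM d L i.m i.kk hL)) A' μ x)) (cvNL d L i.m i.kk hL a ι) (fun _ => 0) -
            tensorId ι (gOp (cvM d L i.m i.kk hL) (L ^ i.kk) a))
          (fun y y' => KX * (c35 * (L : ℝ) ^ i.m * α₀) * Real.exp (-(ρX * (unitTorusGeo L i.kk (cvM d L i.m i.kk hL)).dist y y'))) ∧
        HasMaj (BlockNorm.ofBlocks (unitTorusGeo L i.kk (cvM d L i.m i.kk hL)) (liftBlk (fun b : CvX' d L i.m i.kk i.r hL => blockOf (L ^ i.r * L ^ i.kk) (cvM d L i.m i.kk hL) b.1) ι))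
          (BlockNorm.ofBlocks (unitTorusGeo L i.kk (cvM d L i.m i.kk hL)) (liftBlk (fun b : CvX' d L i.m i.kk i.r hL => blockOf (L ^ i.r * L ^ i.kk) (cvM d L i.m i.kk hL) b.1) ι))
          (cvGlued' d L i.m i.kk i.r hL a ((((L ^ i.r * L ^ i.kk : ℕ) : ℝ))⁻¹) ι e (fun _ _ => (1 : Matrix mm mm ℂ)) (fun μ x' => NormedSpace.exp (((((L ^ i.r * L ^ i.kk : ℕ) : ℝ))⁻¹) • A' μ x'))
              (cvNL' d L i.m i.kk i.r hL a ι) (fun _ => 0) -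
            tensorId ι (gOp (cvM d L i.m i.kk hL) (L ^ i.r * L ^ i.kk) a))
          (fun y y' => KX * (c35 * (L : ℝ) ^ i.m * α₀) * Real.exp (-(ρX * (unitTorusGeo L i.kk (cvM d L i.m i.kk hL)).dist y y'))) ∧
        HasMaj (CvNorm d L i.m i.kk hL ι)
          (BlockNorm.ofBlocks (unitTorusGeo L i.kk (cvM d L i.m i.kk hL)) (liftBlk (fun b : CvX' d L i.m i.kk i.r hL => blockOf (L ^ i.r * L ^ i.kk) (cvM d L i.m i.kk hL) b.1) ι))
          (idef (pull (liftMap (kingPrV L i.kk i.r (cvM d L i.m i.kk hL)) ι)) (pull (liftMap (kingPrV L i.kk i.r (cvM d L i.m i.kk hL)) ι))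
            (cvGlued' d L i.m i.kk i.r hL a ((((L ^ i.r * L ^ i.kk : ℕ) : ℝ))⁻¹) ι e (fun _ _ => (1 : Matrix mm mm ℂ)) (fun μ x' => NormedSpace.exp (((((L ^ i.r * L ^ i.kk : ℕ) : ℝ))⁻¹) • A' μ x'))
                (cvNL' d L i.m i.kk i.r hL a ι) (fun _ => 0) -
              tensorId ι (gOp (cvM d L i.m i.kk hL) (L ^ i.r * L ^ i.kk) a))
            (cvGlued d L i.m i.kk hL a ((((L ^ i.kk : ℕ) : ℝ))⁻¹) ι e (fun _ _ => (1 : Matrix mm mm ℂ))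
                (fun μ x => NormedSpace.exp (((((L ^ i.kk : ℕ) : ℝ))⁻¹) • gavgM (Matrix mm mm ℂ) (Fin (d + 1)) (kingPrV L i.kk i.r (cvM d L i.m i.kk hL)) A' μ x)) (cvNL d L i.m i.kk hL a ι) (fun _ => 0) -
              tensorId ι (gOp (cvM d L i.m i.kk hL) (L ^ i.kk) a)))
          (fun y y' => KX * ((((L ^ i.kk : ℕ) : ℝ)) ^ (-(1 / 16 : ℝ))) * Real.exp (-(ρX * (unitTorusGeo L i.kk (cvM d L i.m i.kk hL)).dist y y'))) := by
  have hLpos : 0 < L := Nat.pos_of_ne_zero (NeZero.ne L)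
  have hLr : (0 : ℝ) < (L : ℝ) := Nat.cast_pos.mpr hLpos
  have hκ0 : 0 ≤ basisConst e := basisConst_nonneg e
  -- (I-b) and (I-c): the increment rows in FILE 133's regime
  obtain ⟨δb, wb, Rb, Kb, hδb, hRb, hKb, Hb⟩ := exists_hasMaj_cvGlued_sub_tensorId_gOp (d := d) hL hL7 ha ι
  obtain ⟨δc, wc, Rc, Kc, hδc, hRc, hKc, Hc⟩ := exists_hasMaj_idef_cvGlued_sub_tensorId_gOp (d := d) hL hL7 ha ι
  -- the regime's thresholds as a window in `r_A = c₃₅L^mα₀`: `W r_A ≤ 1`, `σ κ_e JJ r_A ≤ min R_b R_c`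
  let σ : ℝ := 14 * Real.exp 1 * (1 + Fintype.card (Fin (d + 1))) * basisConst e * ((1 + Fintype.card (Fin (d + 1))) * (3 + 2 * ((d : ℝ) + 1)))
  have hσ0 : 0 ≤ σ := by positivity
  let JJ : ℝ := 1 + Fintype.card (Fin (d + 1) ⊕ Fin (d + 1))
  have hJJ0 : 0 ≤ JJ := by positivity
  let W : ℝ := 2 * ((1 + Fintype.card (Fin (d + 1))) * (3 + 2 * ((d : ℝ) + 1)))
  have hW0 : 0 < W := by positivity
  let sX : ℝ := min (1 / W) (min Rb Rc / (σ * JJ + 1))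
  have hsX : 0 < sX := lt_min (by positivity) (by positivity)
  refine ⟨min δb δc, max (Kb * basisConst e) (Kc * (1 + basisConst e)), max wb wc, sX, lt_min hδb hδc, le_max_of_le_left (by positivity), hsX,
    fun i α₀ A' hα₀ hw hrS hA' => ?_⟩
  set M := cvM d L i.m i.kk hL with hMdef
  have hd := fun y y' => unitTorusGeo_dist_nonneg L i.kk M y y'
  have hwb : wb ≤ ((L ^ i.m : ℕ) : ℝ) := (le_max_left _ _).trans hw
  have hwc : wc ≤ ((L ^ i.m : ℕ) : ℝ) := (le_max_right _ _).trans hw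
  have hkpos : (0 : ℝ) < ((L ^ i.kk : ℕ) : ℝ) := Nat.cast_pos.mpr (pow_pos hLpos _)
  have hx1 : (1 : ℝ) ≤ ((L ^ i.kk : ℕ) : ℝ) := by exact_mod_cast Nat.one_le_pow _ L hLpos
  have hθ0 : 0 ≤ (((L ^ i.kk : ℕ) : ℝ)) ^ (-(1 / 16 : ℝ)) := Real.rpow_nonneg hkpos.le _
  have hη0 : 0 ≤ ((((L ^ i.kk : ℕ) : ℝ)))⁻¹ := inv_nonneg.mpr hkpos.le
  have hηθ : ((((L ^ i.kk : ℕ) : ℝ)))⁻¹ ≤ (((L ^ i.kk : ℕ) : ℝ)) ^ (-(1 / 16 : ℝ)) := by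
    rw [← Real.rpow_neg_one]; exact Real.rpow_le_rpow_of_exponent_le hx1 (by norm_num)
  -- the class at the index
  have hrA0 : 0 ≤ c35 * (L : ℝ) ^ i.m * α₀ := by positivity
  obtain ⟨hskew, h1, h2, h3⟩ := (sfInstance_reg335_iff d mm ι hL i c35 α₀ A').1 hA'
  have hconv : ((L : ℝ) ^ i.kk)⁻¹ * ((L : ℝ) ^ i.r)⁻¹ = (((L ^ i.r * L ^ i.kk : ℕ) : ℝ))⁻¹ := by
    push_cast
    rw [mul_inv, mul_comm]
  have h2' : ∀ μ κ x', ‖A' μ (bshiftEquiv (cvM d L i.m i.kk hL) (L ^ i.r * L ^ i.kk) κ x') - A' μ x'‖ ≤ c35 * (L : ℝ) ^ i.m * α₀ * ((((L ^ i.r * L ^ i.kk : ℕ) : ℝ))⁻¹) :=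
    fun μ κ x' => (h2 μ κ x').trans_eq (by rw [hconv])
  have h3' : ∀ μ κ x', ‖(A' μ (bshiftEquiv (cvM d L i.m i.kk hL) (L ^ i.r * L ^ i.kk) κ x') - A' μ x') -
      (A' μ (bshiftEquiv (cvM d L i.m i.kk hL) (L ^ i.r * L ^ i.kk) κ ((bshiftEquiv (cvM d L i.m i.kk hL) (L ^ i.r * L ^ i.kk) μ).symm x')) -
        A' μ ((bshiftEquiv (cvM d L i.m i.kk hL) (L ^ i.r * L ^ i.kk) μ).symm x'))‖ ≤
      c35 * (L : ℝ) ^ i.m * α₀ * ((((L ^ i.r * L ^ i.kk : ℕ) : ℝ))⁻¹) * ((((L ^ i.r * L ^ i.kk : ℕ) : ℝ))⁻¹) :=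
    fun μ κ x' => (h3 μ κ x').trans_eq (by rw [hconv])
  have hrW : c35 * (L : ℝ) ^ i.m * α₀ ≤ 1 / W := hrS.trans (min_le_left _ _)
  have hrR : c35 * (L : ℝ) ^ i.m * α₀ ≤ min Rb Rc / (σ * JJ + 1) := hrS.trans (min_le_right _ _)
  have hr2 : 2 * ((1 + Fintype.card (Fin (d + 1))) * ((3 + 2 * ((d : ℝ) + 1)) * (c35 * (L : ℝ) ^ i.m * α₀))) ≤ 1 := by
    calc 2 * ((1 + Fintype.card (Fin (d + 1))) * ((3 + 2 * ((d : ℝ) + 1)) * (c35 * (L : ℝ) ^ i.m * α₀))) = W * (c35 * (L : ℝ) ^ i.m * α₀) := by ring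
      _ ≤ W * (1 / W) := mul_le_mul_of_nonneg_left hrW hW0.le
      _ = 1 := by field_simp
  have hscale : 14 * Real.exp 1 * (1 + Fintype.card (Fin (d + 1))) * basisConst e * ((1 + Fintype.card (Fin (d + 1))) * ((3 + 2 * ((d : ℝ) + 1)) * (c35 * (L : ℝ) ^ i.m * α₀))) *
      (1 + Fintype.card (Fin (d + 1) ⊕ Fin (d + 1))) = σ * (c35 * (L : ℝ) ^ i.m * α₀) * JJ := by ring
  have hRmin : σ * (c35 * (L : ℝ) ^ i.m * α₀) * JJ ≤ min Rb Rc := by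
    have hden : 0 < σ * JJ + 1 := by positivity
    have hm0 : 0 ≤ min Rb Rc := le_min hRb.le hRc.le
    calc σ * (c35 * (L : ℝ) ^ i.m * α₀) * JJ = (σ * JJ) * (c35 * (L : ℝ) ^ i.m * α₀) := by ring
      _ ≤ (σ * JJ) * (min Rb Rc / (σ * JJ + 1)) := mul_le_mul_of_nonneg_left hrR (by positivity)
      _ = min Rb Rc * ((σ * JJ) / (σ * JJ + 1)) := by ring
      _ ≤ min Rb Rc * 1 := mul_le_mul_of_nonneg_left ((div_le_one hden).mpr (by linarith)) hm0
      _ = min Rb Rc := mul_one _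
  have hRb' : 14 * Real.exp 1 * (1 + Fintype.card (Fin (d + 1))) * basisConst e * ((1 + Fintype.card (Fin (d + 1))) * ((3 + 2 * ((d : ℝ) + 1)) * (c35 * (L : ℝ) ^ i.m * α₀))) *
      (1 + Fintype.card (Fin (d + 1) ⊕ Fin (d + 1))) ≤ Rb := by rw [hscale]; exact hRmin.trans (min_le_left _ _)
  have hRc' : 14 * Real.exp 1 * (1 + Fintype.card (Fin (d + 1))) * basisConst e * ((1 + Fintype.card (Fin (d + 1))) * ((3 + 2 * ((d : ℝ) + 1)) * (c35 * (L : ℝ) ^ i.m * α₀))) *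
      (1 + Fintype.card (Fin (d + 1) ⊕ Fin (d + 1))) ≤ Rc := by rw [hscale]; exact hRmin.trans (min_le_right _ _)
  -- the two landed rows at this index
  obtain ⟨hb, hb'⟩ := Hb i.m i.kk i.r i.one_le hwb e he A' hskew (c35 * (L : ℝ) ^ i.m * α₀) hrA0 h1 h2' h3' hr2 hRb'
  have hc := Hc i.m i.kk i.r i.one_le hwc e he A' hskew (c35 * (L : ℝ) ^ i.m * α₀) hrA0 h1 h2' h3' hr2 hRc'
  have hbk : cvBlk d L i.m i.kk hL ∘ kingPrV L i.kk i.r (cvM d L i.m i.kk hL) = fun i' : CvX' d L i.m i.kk i.r hL => blockOf (L ^ i.r * L ^ i.kk) (cvM d L i.m i.kk hL) i'.1 :=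
    blkFine_comp_kingPrV (M := cvM d L i.m i.kk hL) L i.kk i.r
  rw [hbk] at hc
  refine ⟨?_, ?_, ?_⟩
  · refine (hasMaj_exp_mono hd (by positivity) (min_le_left δb δc) hb).mono fun y y' => mul_le_mul_of_nonneg_right ?_ (Real.exp_nonneg _)
    calc Kb * basisConst e * (c35 * (L : ℝ) ^ i.m * α₀) = (Kb * basisConst e) * (c35 * (L : ℝ) ^ i.m * α₀) := by ring
      _ ≤ max (Kb * basisConst e) (Kc * (1 + basisConst e)) * (c35 * (L : ℝ) ^ i.m * α₀) := mul_le_mul_of_nonneg_right (le_max_left _ _) hrA0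
  · refine (hasMaj_exp_mono hd (by positivity) (min_le_left δb δc) hb').mono fun y y' => mul_le_mul_of_nonneg_right ?_ (Real.exp_nonneg _)
    calc Kb * basisConst e * (c35 * (L : ℝ) ^ i.m * α₀) = (Kb * basisConst e) * (c35 * (L : ℝ) ^ i.m * α₀) := by ring
      _ ≤ max (Kb * basisConst e) (Kc * (1 + basisConst e)) * (c35 * (L : ℝ) ^ i.m * α₀) := mul_le_mul_of_nonneg_right (le_max_left _ _) hrA0
  · have hamp0 : 0 ≤ Kc * ((((L ^ i.kk : ℕ) : ℝ)) ^ (-(1 / 16 : ℝ)) + basisConst e * (c35 * (L : ℝ) ^ i.m * α₀) * ((((L ^ i.kk : ℕ) : ℝ))⁻¹)) := by positivity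
    have hc₀ : HasMaj (CvNorm d L i.m i.kk hL ι) (BlockNorm.ofBlocks (unitTorusGeo L i.kk M) (liftBlk (fun b : CvX' d L i.m i.kk i.r hL => blockOf (L ^ i.r * L ^ i.kk) M b.1) ι)) _
        (fun y y' => Kc * ((((L ^ i.kk : ℕ) : ℝ)) ^ (-(1 / 16 : ℝ)) + basisConst e * (c35 * (L : ℝ) ^ i.m * α₀) * ((((L ^ i.kk : ℕ) : ℝ))⁻¹)) *
          Real.exp (-(min δb δc * (unitTorusGeo L i.kk M).dist y y'))) := hasMaj_exp_mono hd hamp0 (min_le_right δb δc) hc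
    refine hc₀.mono fun y y' => mul_le_mul_of_nonneg_right ?_ (Real.exp_nonneg _)
    -- `K_c((L^k)^{−1∕16} + κ_e r_A (L^k)⁻¹) ≤ K_c(1 + κ_e)(L^k)^{−1∕16}` (`r_A ≤ 1`)
    have hr1 : c35 * (L : ℝ) ^ i.m * α₀ ≤ 1 := by
      have hW1 : 1 ≤ W := by
        show (1 : ℝ) ≤ 2 * ((1 + Fintype.card (Fin (d + 1))) * (3 + 2 * ((d : ℝ) + 1)))
        have h1 : (1 : ℝ) ≤ 1 + Fintype.card (Fin (d + 1)) := by
          have : (0 : ℝ) ≤ Fintype.card (Fin (d + 1)) := by positivity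
          linarith
        have h2 : (3 : ℝ) ≤ 3 + 2 * ((d : ℝ) + 1) := by
          have : (0 : ℝ) ≤ (d : ℝ) := by positivity
          linarith
        nlinarith
      exact hrW.trans ((div_le_one hW0).mpr hW1)
    have hin : basisConst e * (c35 * (L : ℝ) ^ i.m * α₀) * ((((L ^ i.kk : ℕ) : ℝ))⁻¹) ≤ basisConst e * (((L ^ i.kk : ℕ) : ℝ)) ^ (-(1 / 16 : ℝ)) := by
      calc basisConst e * (c35 * (L : ℝ) ^ i.m * α₀) * ((((L ^ i.kk : ℕ) : ℝ))⁻¹) ≤ basisConst e * 1 * (((L ^ i.kk : ℕ) : ℝ)) ^ (-(1 / 16 : ℝ)) :=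
            mul_le_mul (mul_le_mul_of_nonneg_left hr1 hκ0) hηθ hη0 (by positivity)
        _ = basisConst e * (((L ^ i.kk : ℕ) : ℝ)) ^ (-(1 / 16 : ℝ)) := by ring
    calc Kc * ((((L ^ i.kk : ℕ) : ℝ)) ^ (-(1 / 16 : ℝ)) + basisConst e * (c35 * (L : ℝ) ^ i.m * α₀) * ((((L ^ i.kk : ℕ) : ℝ))⁻¹))
        ≤ Kc * ((((L ^ i.kk : ℕ) : ℝ)) ^ (-(1 / 16 : ℝ)) + basisConst e * (((L ^ i.kk : ℕ) : ℝ)) ^ (-(1 / 16 : ℝ))) := mul_le_mul_of_nonneg_left (by linarith) hKc.le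
      _ = (Kc * (1 + basisConst e)) * ((((L ^ i.kk : ℕ) : ℝ)) ^ (-(1 / 16 : ℝ))) := by ring
      _ ≤ max (Kb * basisConst e) (Kc * (1 + basisConst e)) * ((((L ^ i.kk : ℕ) : ℝ)) ^ (-(1 / 16 : ℝ))) := mul_le_mul_of_nonneg_right (le_max_right _ _) hθ0

/-- ★ **NON-VACUITY ∕ CONSISTENCY**: `ne2PlusSite_foSiteAny` at dag-n15-c's FILE 133 propagator family (rows `rows_cvGlued`) and ANY averaging family with (Q-3)'s rows — pointwise (Q-3)'s kernel
(`foSiteAny_cvGlued`): (Q-3)'s site layer recovered through the generic socket. [bookkeeping] -/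
theorem ne2PlusSite_foSiteAny_cvGlued [Nonempty ι] (hL : Odd L ∧ 1 < L) (hL7 : 7 ≤ L) (ha : 0 < a) {c35 : ℝ} (hc35 : 0 < c35)
    (he : ∀ A B : Matrix mm mm ℂ, traceForm A B = e A ⬝ᵥ e B) (α β : Fin (d + 1)) (j j' : ι) (d' : ℕ) (p : ℝ)
    (Dc : ∀ i : SfIdx d L, (Fin (d + 1) → CvX' d L i.m i.kk i.r hL → Matrix mm mm ℂ) → ((CvX d L i.m i.kk hL × ι → ℝ) →ₗ[ℝ] ((Tor (cvM d L i.m i.kk hL) × Fin (d + 1)) × ι → ℝ)))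
    (Ec : ∀ i : SfIdx d L, (Fin (d + 1) → CvX' d L i.m i.kk i.r hL → Matrix mm mm ℂ) → (((Tor (cvM d L i.m i.kk hL) × Fin (d + 1)) × ι → ℝ) →ₗ[ℝ] (CvX d L i.m i.kk hL × ι → ℝ)))
    (Df : ∀ i : SfIdx d L, (Fin (d + 1) → CvX' d L i.m i.kk i.r hL → Matrix mm mm ℂ) → ((CvX' d L i.m i.kk i.r hL × ι → ℝ) →ₗ[ℝ] ((Tor (cvM d L i.m i.kk hL) × Fin (d + 1)) × ι → ℝ)))
    (Ef : ∀ i : SfIdx d L, (Fin (d + 1) → CvX' d L i.m i.kk i.r hL → Matrix mm mm ℂ) → (((Tor (cvM d L i.m i.kk hL) × Fin (d + 1)) × ι → ℝ) →ₗ[ℝ] (CvX' d L i.m i.kk i.r hL × ι → ℝ)))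
    (hfam : ∀ ρ : ℝ, 0 < ρ → ∃ KD s₀ : ℝ, 0 ≤ KD ∧ 0 < s₀ ∧
      ∀ (i : SfIdx d L) (α₀ : ℝ) (A' : Fin (d + 1) → CvX' d L i.m i.kk i.r hL → Matrix mm mm ℂ), 0 < α₀ → c35 * (L : ℝ) ^ i.m * α₀ ≤ s₀ → (sfInstance d mm ι hL i).Bf.Reg335 c35 α₀ A' →
        HasMaj (CvNorm d L i.m i.kk hL ι) (BlockNorm.ofBlocks (unitTorusGeo L i.kk (cvM d L i.m i.kk hL)) (liftBlk (fun b : Tor (cvM d L i.m i.kk hL) × Fin (d + 1) => b.1) ι)) (Dc i A')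
          (fun y y' => KD * (c35 * (L : ℝ) ^ i.m * α₀) * Real.exp (-(ρ * (unitTorusGeo L i.kk (cvM d L i.m i.kk hL)).dist y y'))) ∧
        HasMaj (BlockNorm.ofBlocks (unitTorusGeo L i.kk (cvM d L i.m i.kk hL)) (liftBlk (fun b : CvX' d L i.m i.kk i.r hL => blockOf (L ^ i.r * L ^ i.kk) (cvM d L i.m i.kk hL) b.1) ι))
          (BlockNorm.ofBlocks (unitTorusGeo L i.kk (cvM d L i.m i.kk hL)) (liftBlk (fun b : Tor (cvM d L i.m i.kk hL) × Fin (d + 1) => b.1) ι)) (Df i A')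
          (fun y y' => KD * (c35 * (L : ℝ) ^ i.m * α₀) * Real.exp (-(ρ * (unitTorusGeo L i.kk (cvM d L i.m i.kk hL)).dist y y'))) ∧
        HasMaj (BlockNorm.ofBlocks (unitTorusGeo L i.kk (cvM d L i.m i.kk hL)) (liftBlk (fun b : Tor (cvM d L i.m i.kk hL) × Fin (d + 1) => b.1) ι)) (CvNorm d L i.m i.kk hL ι) (Ec i A')
          (fun y y' => KD * (c35 * (L : ℝ) ^ i.m * α₀) * Real.exp (-(ρ * (unitTorusGeo L i.kk (cvM d L i.m i.kk hL)).dist y y'))) ∧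
        HasMaj (BlockNorm.ofBlocks (unitTorusGeo L i.kk (cvM d L i.m i.kk hL)) (liftBlk (fun b : Tor (cvM d L i.m i.kk hL) × Fin (d + 1) => b.1) ι))
          (BlockNorm.ofBlocks (unitTorusGeo L i.kk (cvM d L i.m i.kk hL)) (liftBlk (fun b : CvX' d L i.m i.kk i.r hL => blockOf (L ^ i.r * L ^ i.kk) (cvM d L i.m i.kk hL) b.1) ι)) (Ef i A')
          (fun y y' => KD * (c35 * (L : ℝ) ^ i.m * α₀) * Real.exp (-(ρ * (unitTorusGeo L i.kk (cvM d L i.m i.kk hL)).dist y y'))) ∧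
        HasMaj (CvNorm d L i.m i.kk hL ι) (BlockNorm.ofBlocks (unitTorusGeo L i.kk (cvM d L i.m i.kk hL)) (liftBlk (fun b : Tor (cvM d L i.m i.kk hL) × Fin (d + 1) => b.1) ι))
          (Df i A' ∘ₗ pull (liftMap (kingPrV L i.kk i.r (cvM d L i.m i.kk hL)) ι) - Dc i A')
          (fun y y' => KD * ((((L ^ i.kk : ℕ) : ℝ)) ^ (-(1 / 16 : ℝ))) * Real.exp (-(ρ * (unitTorusGeo L i.kk (cvM d L i.m i.kk hL)).dist y y'))) ∧
        HasMaj (BlockNorm.ofBlocks (unitTorusGeo L i.kk (cvM d L i.m i.kk hL)) (liftBlk (fun b : Tor (cvM d L i.m i.kk hL) × Fin (d + 1) => b.1) ι))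
          (BlockNorm.ofBlocks (unitTorusGeo L i.kk (cvM d L i.m i.kk hL)) (liftBlk (fun b : CvX' d L i.m i.kk i.r hL => blockOf (L ^ i.r * L ^ i.kk) (cvM d L i.m i.kk hL) b.1) ι))
          (Ef i A' - pull (liftMap (kingPrV L i.kk i.r (cvM d L i.m i.kk hL)) ι) ∘ₗ Ec i A')
          (fun y y' => KD * ((((L ^ i.kk : ℕ) : ℝ)) ^ (-(1 / 16 : ℝ))) * Real.exp (-(ρ * (unitTorusGeo L i.kk (cvM d L i.m i.kk hL)).dist y y')))) :
    NE2PlusSite d' p c35 (sfInstance d mm ι hL)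
      (foSiteAny d mm ι a hL α β j j'
        (fun i A' => cvGlued d L i.m i.kk hL a ((((L ^ i.kk : ℕ) : ℝ))⁻¹) ι e (fun _ _ => (1 : Matrix mm mm ℂ))
          (fun μ x => NormedSpace.exp (((((L ^ i.kk : ℕ) : ℝ))⁻¹) • gavgM (Matrix mm mm ℂ) (Fin (d + 1)) (kingPrV L i.kk i.r (cvM d L i.m i.kk hL)) A' μ x)) (cvNL d L i.m i.kk hL a ι) (fun _ => 0))
        (fun i A' => cvGlued' d L i.m i.kk i.r hL a ((((L ^ i.r * L ^ i.kk : ℕ) : ℝ))⁻¹) ι e (fun _ _ => (1 : Matrix mm mm ℂ))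
          (fun μ x' => NormedSpace.exp (((((L ^ i.r * L ^ i.kk : ℕ) : ℝ))⁻¹) • A' μ x')) (cvNL' d L i.m i.kk i.r hL a ι) (fun _ => 0))
        Dc Ec Df Ef) :=
  ne2PlusSite_foSiteAny d mm ι a hL hL7 ha hc35 α β j j' d' p _ _ Dc Ec Df Ef (rows_cvGlued hL hL7 ha hc35 (e := e) he) hfam

/-! ## §2 The generic unit layer at that family -/

/-- ★ **NON-VACUITY ∕ CONSISTENCY**: `ne2PlusUnit_foCovAnyLam` at dag-n15-c's FILE 133 propagator family (rows (𝟙P-c) `rows_cvGlued`) and ANY averaging family with (Q-4)'s rows —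
pointwise (Q-4)'s kernel (`foCovAnyLam_cvGlued`): (Q-4)'s unit layer recovered through the generic socket. [bookkeeping] -/
theorem ne2PlusUnit_foCovAnyLam_cvGlued [Nonempty ι] (hd : 1 ≤ d) (hL : Odd L ∧ 1 < L) (hL7 : 7 ≤ L) (ha : 0 < a) {c35 : ℝ} (hc35 : 0 < c35)
    (he : ∀ A B : Matrix mm mm ℂ, traceForm A B = e A ⬝ᵥ e B) (α β : Fin (d + 1)) (j j' : ι)
    (Dc : ∀ i : SfIdx d L, (Fin (d + 1) → CvX' d L i.m i.kk i.r hL → Matrix mm mm ℂ) → ((CvX d L i.m i.kk hL × ι → ℝ) →ₗ[ℝ] ((Tor (cvM d L i.m i.kk hL) × Fin (d + 1)) × ι → ℝ)))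
    (Ec : ∀ i : SfIdx d L, (Fin (d + 1) → CvX' d L i.m i.kk i.r hL → Matrix mm mm ℂ) → (((Tor (cvM d L i.m i.kk hL) × Fin (d + 1)) × ι → ℝ) →ₗ[ℝ] (CvX d L i.m i.kk hL × ι → ℝ)))
    (Df : ∀ i : SfIdx d L, (Fin (d + 1) → CvX' d L i.m i.kk i.r hL → Matrix mm mm ℂ) → ((CvX' d L i.m i.kk i.r hL × ι → ℝ) →ₗ[ℝ] ((Tor (cvM d L i.m i.kk hL) × Fin (d + 1)) × ι → ℝ)))
    (Ef : ∀ i : SfIdx d L, (Fin (d + 1) → CvX' d L i.m i.kk i.r hL → Matrix mm mm ℂ) → (((Tor (cvM d L i.m i.kk hL) × Fin (d + 1)) × ι → ℝ) →ₗ[ℝ] (CvX' d L i.m i.kk i.r hL × ι → ℝ)))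
    (hfam : ∀ ρ : ℝ, 0 < ρ → ∃ KD s₀ : ℝ, 0 ≤ KD ∧ 0 < s₀ ∧
      ∀ (i : SfIdx d L) (α₀ : ℝ) (A' : Fin (d + 1) → CvX' d L i.m i.kk i.r hL → Matrix mm mm ℂ), 0 < α₀ → c35 * (L : ℝ) ^ i.m * α₀ ≤ s₀ → (sfInstance d mm ι hL i).Bf.Reg335 c35 α₀ A' →
        HasMaj (CvNorm d L i.m i.kk hL ι) (BlockNorm.ofBlocks (unitTorusGeo L i.kk (cvM d L i.m i.kk hL)) (liftBlk (fun b : Tor (cvM d L i.m i.kk hL) × Fin (d + 1) => b.1) ι)) (Dc i A')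
          (fun y y' => KD * (c35 * (L : ℝ) ^ i.m * α₀) * Real.exp (-(ρ * (unitTorusGeo L i.kk (cvM d L i.m i.kk hL)).dist y y'))) ∧
        HasMaj (BlockNorm.ofBlocks (unitTorusGeo L i.kk (cvM d L i.m i.kk hL)) (liftBlk (fun b : CvX' d L i.m i.kk i.r hL => blockOf (L ^ i.r * L ^ i.kk) (cvM d L i.m i.kk hL) b.1) ι))
          (BlockNorm.ofBlocks (unitTorusGeo L i.kk (cvM d L i.m i.kk hL)) (liftBlk (fun b : Tor (cvM d L i.m i.kk hL) × Fin (d + 1) => b.1) ι)) (Df i A')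
          (fun y y' => KD * (c35 * (L : ℝ) ^ i.m * α₀) * Real.exp (-(ρ * (unitTorusGeo L i.kk (cvM d L i.m i.kk hL)).dist y y'))) ∧
        HasMaj (BlockNorm.ofBlocks (unitTorusGeo L i.kk (cvM d L i.m i.kk hL)) (liftBlk (fun b : Tor (cvM d L i.m i.kk hL) × Fin (d + 1) => b.1) ι)) (CvNorm d L i.m i.kk hL ι) (Ec i A')
          (fun y y' => KD * (c35 * (L : ℝ) ^ i.m * α₀) * Real.exp (-(ρ * (unitTorusGeo L i.kk (cvM d L i.m i.kk hL)).dist y y'))) ∧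
        HasMaj (BlockNorm.ofBlocks (unitTorusGeo L i.kk (cvM d L i.m i.kk hL)) (liftBlk (fun b : Tor (cvM d L i.m i.kk hL) × Fin (d + 1) => b.1) ι))
          (BlockNorm.ofBlocks (unitTorusGeo L i.kk (cvM d L i.m i.kk hL)) (liftBlk (fun b : CvX' d L i.m i.kk i.r hL => blockOf (L ^ i.r * L ^ i.kk) (cvM d L i.m i.kk hL) b.1) ι)) (Ef i A')
          (fun y y' => KD * (c35 * (L : ℝ) ^ i.m * α₀) * Real.exp (-(ρ * (unitTorusGeo L i.kk (cvM d L i.m i.kk hL)).dist y y'))) ∧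
        HasMaj (CvNorm d L i.m i.kk hL ι) (BlockNorm.ofBlocks (unitTorusGeo L i.kk (cvM d L i.m i.kk hL)) (liftBlk (fun b : Tor (cvM d L i.m i.kk hL) × Fin (d + 1) => b.1) ι))
          (Df i A' ∘ₗ pull (liftMap (kingPrV L i.kk i.r (cvM d L i.m i.kk hL)) ι) - Dc i A')
          (fun y y' => KD * ((((L ^ i.kk : ℕ) : ℝ)) ^ (-(1 / 16 : ℝ))) * Real.exp (-(ρ * (unitTorusGeo L i.kk (cvM d L i.m i.kk hL)).dist y y'))) ∧
        HasMaj (BlockNorm.ofBlocks (unitTorusGeo L i.kk (cvM d L i.m i.kk hL)) (liftBlk (fun b : Tor (cvM d L i.m i.kk hL) × Fin (d + 1) => b.1) ι))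
          (BlockNorm.ofBlocks (unitTorusGeo L i.kk (cvM d L i.m i.kk hL)) (liftBlk (fun b : CvX' d L i.m i.kk i.r hL => blockOf (L ^ i.r * L ^ i.kk) (cvM d L i.m i.kk hL) b.1) ι))
          (Ef i A' - pull (liftMap (kingPrV L i.kk i.r (cvM d L i.m i.kk hL)) ι) ∘ₗ Ec i A')
          (fun y y' => KD * ((((L ^ i.kk : ℕ) : ℝ)) ^ (-(1 / 16 : ℝ))) * Real.exp (-(ρ * (unitTorusGeo L i.kk (cvM d L i.m i.kk hL)).dist y y')))) :
    ∃ w : ℝ, NE2PlusUnit c35 (fun i : SfIdxGE d L w × Finset (Fin (d + 1) → ℤ) => sfInstance d mm ι hL i.1.1)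
      (fun i => foCovAnyLam d mm ι a hL α β j j'
        (fun i A' => cvGlued d L i.m i.kk hL a ((((L ^ i.kk : ℕ) : ℝ))⁻¹) ι e (fun _ _ => (1 : Matrix mm mm ℂ))
          (fun μ x => NormedSpace.exp (((((L ^ i.kk : ℕ) : ℝ))⁻¹) • gavgM (Matrix mm mm ℂ) (Fin (d + 1)) (kingPrV L i.kk i.r (cvM d L i.m i.kk hL)) A' μ x)) (cvNL d L i.m i.kk hL a ι) (fun _ => 0))
        (fun i A' => cvGlued' d L i.m i.kk i.r hL a ((((L ^ i.r * L ^ i.kk : ℕ) : ℝ))⁻¹) ι e (fun _ _ => (1 : Matrix mm mm ℂ))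
          (fun μ x' => NormedSpace.exp (((((L ^ i.r * L ^ i.kk : ℕ) : ℝ))⁻¹) • A' μ x')) (cvNL' d L i.m i.kk i.r hL a ι) (fun _ => 0))
        Dc Ec Df Ef i.1.1 i.2)
      (fun i => inLamSf d mm ι hL i.1.1 i.2) (fun i => (sfInstance d mm ι hL i.1.1).gc.dist) :=
  ne2PlusUnit_foCovAnyLam d mm ι a hd hL hL7 ha hc35 α β j j' _ _ Dc Ec Df Ef (rows_cvGlued hL hL7 ha hc35 (e := e) he) hfam

end Summit.QuantumFields.YangMills.BalabanUVNodes.N15.SiteLayerSf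

end
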